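import Summits.QuantumFields.YangMills.Theorems.FluctuationComparisonRegPrIntLS2BetaLiftLadderOneProfileTower
import HarnessLib

/-!
# S2β · THE SUP CHAIN, (LIFT-LAD′) ONE-PROFILE — THE TOP ROW: ON THE FIBRE `E′(0) ≤ D′(0)` (the relative lift is `1` at the top, comb bonds carry `η = 1`)

Cell `ym3-torus` (YM ladder rung R3 = continuum `SU(2)` Yang–Mills on the three-torus at fixed lattice data — a RUNG: NOT d = 4, NOT infinite volume,
NOT a mass gap, NOT Clay).  Width seat «width 20» `ym3-torus-px20` (gen 24), FREE px helper on crux `stmt-QuantumFields-20520`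
(`…Theses.UnitScaleTilt.FluctuationComparisonRegPrIntL`), LINE g18-1 S2β, the (ST) sup chain; c₃ assembler (ARCHITECT px17 g22 19:24:49Z ∕ 19:37:59Z).
COMPANION OF ✓p832977 `…LiftLadderOneProfileTower.liftRow'` (`hREC′`: `E′(t+1) ≤ A·E′(t) + (1+κ⁻¹)·D′(t+1)`): the stations ✓p831454∕✓p832110∕✓p832552 also need the TOP row
`hTOP : E′(0) ≤ c 0`.  ON THE FIBRE the two top stage fields COINCIDE (`htop` at internal height `s + 1 = K − J` — the conclusion shape of ✓`stageField_top_eq` from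
`AxStage`'s fibre clauses), so the relative lift `R` of the level-`(J+1)` bonds is `1` and (T4)×2 make the stage chord `1` on every tree-comb bond (✓p828327
`stageChord_treeComb_eq_one_of_top`); hence POINTWISE the (ST′) summand at `t = 0` is bounded by the truncated discrepancy field off the comb, with the SAME `R⁻¹η` letter
as `liftRow'`'s `D′` — `E′(0) ≤ D′(0)` (so the station's uniform `c := fun u => (1+κ⁻¹)·D′(u)` inhabits `hTOP` too, `1 ≤ 1+κ⁻¹`).  (The px20 g23∕px5 g23 remark «on the fibre
the level-J chords are identically 1, so the top row is sources-only» — here by kernel.)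
`--kind proof --supports stmt-QuantumFields-20520 --as helper`, count-neutral, DEFINITION-FREE (0 `def`, 0 `instance`, 0 `notation`, 0 `sorry`, default heartbeats).

WHAT IS PROVED (sorry-free).  ★★★`topRow'` — under ✓p831621 `combRow'`'s binders `hJK U₀ ζ lift U₁ g g₀ hT3 hT4 hT3' hT4' hU₀` VERBATIM (hat weights∕lift FORMULA and the arc
profile NOT needed), for `s` with `s + 1 = K − J`, `0 < K − J`, and `htop : g (s+1) • Ū^{s+1}(expPoint ζ • U₀) = g₀ (s+1) • Ū^{s+1} U₁`:
`E′(0) ≤ Σ_B ‖(fun ℓ′ : PBond (F.P (J+(0+1))) 0 => if READ′_0(B)(ℓ′) ∧ ¬comb(ℓ′) then logVec (su2Quat (R⁻¹η at σ₂ℓ′, height s)) else 0)‖²` — `E′` = the stations' READ′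
lambda VERBATIM applied at `0` (its `J + (0+1)`, `blockIter (0+1)` spelling kept on the right so the two sides live on the same bond type).
Proof: pointwise `‖E-entry ℓ″‖ ≤ ‖D-entry ℓ″‖` (raw = stage arc ✓`norm_logVec_rawChord_eq_stageChord`; comb ⇒ `1` by ✓`stageChord_treeComb_eq_one_of_top` through
✓`treeComb_siteShift`; non-comb ⇒ `R = 1` by `htop`), then `pi_norm_le_iff_of_nonneg` and squaring.

INHABITATION (★★OWNER RULING №100): LAW-FREE; `htop` is the fibre∕top clause of `AxStage` (✓`axStage_exists`: `g j = 1` for `K − J ≤ j`, the two `Ū^{K−J}`-invariance clauses,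
`w • U₀ = (g 0⁻¹·g₀ 0) • U₁`, and `U₀, U` fibre mates — assembled by ✓`stageField_top_eq`).

HONEST SCOPE.  Group algebra and lattice bookkeeping over landed letters by name; nothing of Bałaban's renormalisation-group analysis is asserted or proved ([Balaban1985Averaging]
(58) p.27, Prop. 4 (128)–(135) pp.37–38; [Balaban1985RegularSpaces] (1.19) p.79; [Balaban1987RG1] (0.11) p.253); the budgets (SCT′), (ST″)∕(ST′)∕(ST), LOC″∕LOC are
HYPOTHESES ∕ other files; GAP♯∘ (`stub_uniformFibreGapOrbit`, registry 3732b7df UNTOUCHED), the five registered stubs (0∕5), S2β, 20520, 19936, 19200, `YM3TorusSU2` are NOT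
proved; no registered stub is closed; rung R3 — NOT d = 4, NOT infinite volume, NOT a mass gap, NOT Clay; the Yang–Mills mass gap is NOT proved.
-/

set_option autoImplicit false

namespace Summit.QuantumFields.YangMills.Theorems.FluctuationComparisonRegPrIntLS2BetaLiftLadderOneProfileTop

open Finset
open scoped Real
open Literature.MathematicalPhysics.QuantumLattice (su2Quat)
open Literature.MathematicalPhysics.QuantumFieldTheory.Balaban1983to89
open T4Continuum T3ContinuumYM3Torus T3TiltDescent T3LevelShift BlockAveraging
open B10Eq27TorusAxialLog (rel axialT)
open T4CubeChartGnomonic (SU2)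
open T4HaarSU2ExpChart (expPoint)
open T4ExpWindowSmallField (logVec)
open Summit.QuantumFields.YangMills.Theorems.FluctuationComparisonRegPrIntLS2BetaLiftLadderCombRow (norm_logVec_rawChord_eq_stageChord)
open Summit.QuantumFields.YangMills.Theorems.FluctuationComparisonRegPrIntLS2BetaLiftLadderCombRowTower (descendTo_apply_eq_iter_of_eq treeComb_siteShift)
open Summit.QuantumFields.YangMills.Theorems.FluctuationComparisonRegPrIntLS2BetaTreeCombBondStep (stageChord_treeComb_eq_one_of_top)

variable {F : T3Family}

open T3UnitLawDensityEML (ℰp)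

/-- ★★★ **THE TOP ROW OF THE ONE-PROFILE LADDER, ON THE FIBRE: `E′(0) ≤ D′(0)`.**  At the top stage the two coarse stage fields COINCIDE (`htop`, the fibre clause of
`AxStage` — ✓`stageField_top_eq`'s conclusion at internal height `s + 1 = K − J`), so the relative lift `R` is `1` at every level-`(J+1)` bond and, by (T4)×2, the stage
chord is `1` on every tree-comb bond (✓p828327 `stageChord_treeComb_eq_one_of_top`); hence the (ST′) summand at `t = 0` is bounded by the truncated discrepancy energy
off the comb with the SAME `R⁻¹η` letter as ✓p832977 `liftRow'` (here `R = 1`): `E′(0) ≤ D′(0)`, and `E′(0) ≤ (1+κ⁻¹)·D′(0)` for the station's uniform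
`c := fun u => (1+κ⁻¹)·D′(u)` (✓p831454∕✓p832110∕✓p832552 `hTOP`).  Binders = ✓`combRow'`'s `hJK … hU₀` VERBATIM, `s` with `s + 1 = K − J`, `htop` at `s+1`.
[cite: Balaban1985Averaging, (58) p.27, Prop. 4 (128)-(135) p.37-38; Balaban1985RegularSpaces, (1.19) p.79; Balaban1987RG1, (0.11) p.253] -/
theorem topRow'  {J K : ℕ} (hJK : J ≤ K) (U₀ : GaugeField (F.P K) 0 (Matrix.specialUnitaryGroup (Fin 2) ℂ)) (ζ : PBond (F.P K) 0 → EuclideanSpace ℝ (Fin 3))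
    (lift : (j : ℕ) → GaugeField (F.P K) (j + 1) SU2 → GaugeField (F.P K) j SU2)
    (U₁ : GaugeField (F.P K) 0 SU2) (g g₀ : (j : ℕ) → Site (F.P K) j → SU2)
    (hT3 : ∀ X : GaugeField (F.P K) 0 SU2, ∀ j, j ≤ K - J →
      Averaging.iter (fun k => blockAvg (P := F.P K) (j := k) ℰp) j (GaugeField.gaugeAct (g 0) X) =
        GaugeField.gaugeAct (g j) (Averaging.iter (fun k => blockAvg (P := F.P K) (j := k) ℰp) j X))
    (hT4 : ∀ j, j < K - J → ∀ x,
      axialT (GaugeField.gaugeAct (g j) (Averaging.iter (fun k => blockAvg (P := F.P K) (j := k) ℰp) j (fun ℓ => expPoint (ζ ℓ) * U₀ ℓ))) (emb (blockOf x)) x =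
        axialT (lift j (GaugeField.gaugeAct (g (j + 1)) (Averaging.iter (fun k => blockAvg (P := F.P K) (j := k) ℰp) (j + 1) (fun ℓ => expPoint (ζ ℓ) * U₀ ℓ))))
          (emb (blockOf x)) x)
    (hT3' : ∀ X : GaugeField (F.P K) 0 SU2, ∀ j, j ≤ K - J →
      Averaging.iter (fun k => blockAvg (P := F.P K) (j := k) ℰp) j (GaugeField.gaugeAct (g₀ 0) X) =
        GaugeField.gaugeAct (g₀ j) (Averaging.iter (fun k => blockAvg (P := F.P K) (j := k) ℰp) j X))
    (hT4' : ∀ j, j < K - J → ∀ x,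
      axialT (GaugeField.gaugeAct (g₀ j) (Averaging.iter (fun k => blockAvg (P := F.P K) (j := k) ℰp) j U₁)) (emb (blockOf x)) x =
        axialT (lift j (GaugeField.gaugeAct (g₀ (j + 1)) (Averaging.iter (fun k => blockAvg (P := F.P K) (j := k) ℰp) (j + 1) U₁)))
          (emb (blockOf x)) x)
    (hU₀ : U₀ = GaugeField.gaugeAct (fun x => (g 0 x)⁻¹ * g₀ 0 x) U₁) :
    ∀ (s : ℕ) (hs : s + 1 = K - J) (h0 : 0 < K - J)
      (htop : GaugeField.gaugeAct (g (s + 1)) (Averaging.iter (fun k => blockAvg (P := F.P K) (j := k) ℰp) (s + 1) (fun ℓ => expPoint (ζ ℓ) * U₀ ℓ)) =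
        GaugeField.gaugeAct (g₀ (s + 1)) (Averaging.iter (fun k => blockAvg (P := F.P K) (j := k) ℰp) (s + 1) U₁)),
      (fun (t : ℕ) (ht : t < K - J) => ∑ B : PBond (F.P J) 0,
            ‖(fun ℓ' : PBond (F.P (J + (t + 1))) 0 =>
              if ∃ z : Site (F.P (J + (t + 1))) 0,
                (B14.Eq22Determines.blockIter (t + 1) z = (bondShift (F.sitesPerDir_eq (m := F.m) (K := J) (j := 0) (m' := F.m) (K' := J + (t + 1)) (j' := t + 1) (by omega)) B).src ∨ B14.Eq22Determines.blockIter (t + 1) z = (bondShift (F.sitesPerDir_eq (m := F.m) (K := J) (j := 0) (m' := F.m) (K' := J + (t + 1)) (j' := t + 1) (by omega)) B).tgt) ∧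
                ∀ ν, (B10Eq27TorusAxialLog.rel z ℓ'.src ν).natAbs ≤ 2
              then logVec (su2Quat (descendTo F ℰp (J + (t + 1)) K (by omega) (fun ℓ => expPoint (ζ ℓ) * U₀ ℓ : GaugeField (F.P K) 0 (Matrix.specialUnitaryGroup (Fin 2) ℂ)) ℓ' * (descendTo F ℰp (J + (t + 1)) K (by omega) U₀ ℓ')⁻¹)) else 0)‖ ^ 2) 0 h0 ≤
        ∑ B : PBond (F.P J) 0,
            ‖(fun ℓ' : PBond (F.P (J + (0 + 1))) 0 =>
              if (∃ z : Site (F.P (J + (0 + 1))) 0,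
                (B14.Eq22Determines.blockIter (0 + 1) z = (bondShift (F.sitesPerDir_eq (m := F.m) (K := J) (j := 0) (m' := F.m) (K' := J + (0 + 1)) (j' := 0 + 1) (by omega)) B).src ∨ B14.Eq22Determines.blockIter (0 + 1) z = (bondShift (F.sitesPerDir_eq (m := F.m) (K := J) (j := 0) (m' := F.m) (K' := J + (0 + 1)) (j' := 0 + 1) (by omega)) B).tgt) ∧
                ∀ ν, (B10Eq27TorusAxialLog.rel z ℓ'.src ν).natAbs ≤ 2) ∧
                ¬ (blockOf (ℓ'.src.shift ℓ'.dir) = blockOf ℓ'.src ∧ ∀ ν, ν < ℓ'.dir → B10Eq27TorusAxialLog.rel (emb (blockOf ℓ'.src)) ℓ'.src ν = 0)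
              then logVec (su2Quat ((lift s (GaugeField.gaugeAct (g (s + 1)) (Averaging.iter (fun k => blockAvg (P := F.P K) (j := k) ℰp) (s + 1) (fun ℓ => expPoint (ζ ℓ) * U₀ ℓ))) (bondShift (F.sitesPerDir_eq (m := F.m) (K := J + (0 + 1)) (j := 0) (m' := F.m) (K' := K) (j' := s) (by omega)) ℓ') *
                    (lift s (GaugeField.gaugeAct (g₀ (s + 1)) (Averaging.iter (fun k => blockAvg (P := F.P K) (j := k) ℰp) (s + 1) U₁)) (bondShift (F.sitesPerDir_eq (m := F.m) (K := J + (0 + 1)) (j := 0) (m' := F.m) (K' := K) (j' := s) (by omega)) ℓ'))⁻¹)⁻¹ *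
                  (GaugeField.gaugeAct (g s) (Averaging.iter (fun k => blockAvg (P := F.P K) (j := k) ℰp) s (fun ℓ => expPoint (ζ ℓ) * U₀ ℓ)) (bondShift (F.sitesPerDir_eq (m := F.m) (K := J + (0 + 1)) (j := 0) (m' := F.m) (K' := K) (j' := s) (by omega)) ℓ') *
                    (GaugeField.gaugeAct (g₀ s) (Averaging.iter (fun k => blockAvg (P := F.P K) (j := k) ℰp) s U₁) (bondShift (F.sitesPerDir_eq (m := F.m) (K := J + (0 + 1)) (j := 0) (m' := F.m) (K' := K) (j' := s) (by omega)) ℓ'))⁻¹))) else 0)‖ ^ 2 := by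
  have _h := hJK
  intro s hs h0 htop
  beta_reduce
  have hsd : s = K - (J + (0 + 1)) := by omega
  have hsK : s + 1 ≤ (F.P K).m + (F.P K).K := by show s + 1 ≤ F.m + K; omega
  have hsle : s ≤ K - J := by omega
  have hslt : s < K - J := by omega
  have P₂ : (F.P (J + (0 + 1))).sitesPerDir 0 = (F.P K).sitesPerDir s := F.sitesPerDir_eq (by omega)
  have Q₁ : (F.P (J + (0 + 1))).sitesPerDir 1 = (F.P K).sitesPerDir (s + 1) := F.sitesPerDir_eq (by omega)
  refine Finset.sum_le_sum fun B _ => ?_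
  refine pow_le_pow_left₀ (norm_nonneg _) ((pi_norm_le_iff_of_nonneg (norm_nonneg _)).2 fun ℓ'' => ?_) 2
  -- pointwise: the `E′` entry at `ℓ″` is bounded by the `D′` entry at `ℓ″`
  refine le_trans ?_ (norm_le_pi_norm
    (fun ℓ' : PBond (F.P (J + (0 + 1))) 0 =>
              if (∃ z : Site (F.P (J + (0 + 1))) 0,
                (B14.Eq22Determines.blockIter (0 + 1) z = (bondShift (F.sitesPerDir_eq (m := F.m) (K := J) (j := 0) (m' := F.m) (K' := J + (0 + 1)) (j' := 0 + 1) (by omega)) B).src ∨ B14.Eq22Determines.blockIter (0 + 1) z = (bondShift (F.sitesPerDir_eq (m := F.m) (K := J) (j := 0) (m' := F.m) (K' := J + (0 + 1)) (j' := 0 + 1) (by omega)) B).tgt) ∧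
                ∀ ν, (B10Eq27TorusAxialLog.rel z ℓ'.src ν).natAbs ≤ 2) ∧
                ¬ (blockOf (ℓ'.src.shift ℓ'.dir) = blockOf ℓ'.src ∧ ∀ ν, ν < ℓ'.dir → B10Eq27TorusAxialLog.rel (emb (blockOf ℓ'.src)) ℓ'.src ν = 0)
              then logVec (su2Quat ((lift s (GaugeField.gaugeAct (g (s + 1)) (Averaging.iter (fun k => blockAvg (P := F.P K) (j := k) ℰp) (s + 1) (fun ℓ => expPoint (ζ ℓ) * U₀ ℓ))) (bondShift (F.sitesPerDir_eq (m := F.m) (K := J + (0 + 1)) (j := 0) (m' := F.m) (K' := K) (j' := s) (by omega)) ℓ') *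
                    (lift s (GaugeField.gaugeAct (g₀ (s + 1)) (Averaging.iter (fun k => blockAvg (P := F.P K) (j := k) ℰp) (s + 1) U₁)) (bondShift (F.sitesPerDir_eq (m := F.m) (K := J + (0 + 1)) (j := 0) (m' := F.m) (K' := K) (j' := s) (by omega)) ℓ'))⁻¹)⁻¹ *
                  (GaugeField.gaugeAct (g s) (Averaging.iter (fun k => blockAvg (P := F.P K) (j := k) ℰp) s (fun ℓ => expPoint (ζ ℓ) * U₀ ℓ)) (bondShift (F.sitesPerDir_eq (m := F.m) (K := J + (0 + 1)) (j := 0) (m' := F.m) (K' := K) (j' := s) (by omega)) ℓ') *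
                    (GaugeField.gaugeAct (g₀ s) (Averaging.iter (fun k => blockAvg (P := F.P K) (j := k) ℰp) s U₁) (bondShift (F.sitesPerDir_eq (m := F.m) (K := J + (0 + 1)) (j := 0) (m' := F.m) (K' := K) (j' := s) (by omega)) ℓ'))⁻¹))) else 0) ℓ'')
  by_cases hS : (∃ z : Site (F.P (J + (0 + 1))) 0,
                (B14.Eq22Determines.blockIter (0 + 1) z = (bondShift (F.sitesPerDir_eq (m := F.m) (K := J) (j := 0) (m' := F.m) (K' := J + (0 + 1)) (j' := 0 + 1) (by omega)) B).src ∨ B14.Eq22Determines.blockIter (0 + 1) z = (bondShift (F.sitesPerDir_eq (m := F.m) (K := J) (j := 0) (m' := F.m) (K' := J + (0 + 1)) (j' := 0 + 1) (by omega)) B).tgt) ∧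
                ∀ ν, (B10Eq27TorusAxialLog.rel z ℓ''.src ν).natAbs ≤ 2)
  · rw [if_pos hS]
    -- raw chord at height `s` = stage chord (arc is a class function)
    rw [descendTo_apply_eq_iter_of_eq F (n := J + (0 + 1)) (by omega) hsd (fun ℓ => expPoint (ζ ℓ) * U₀ ℓ) ℓ'',
      descendTo_apply_eq_iter_of_eq F (n := J + (0 + 1)) (by omega) hsd U₀ ℓ'',
      norm_logVec_rawChord_eq_stageChord (fun k => blockAvg (P := F.P K) (j := k) ℰp) g g₀ (fun ℓ => expPoint (ζ ℓ) * U₀ ℓ) U₁ U₀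
        (fun X => hT3 X s hsle) (fun X => hT3' X s hsle) hU₀ _]
    by_cases hcomb : blockOf (ℓ''.src.shift ℓ''.dir) = blockOf ℓ''.src ∧ ∀ ν, ν < ℓ''.dir → B10Eq27TorusAxialLog.rel (emb (blockOf ℓ''.src)) ℓ''.src ν = 0
    · -- comb bond at the top: the stage chord is `1`
      obtain ⟨hblk', hlo'⟩ := treeComb_siteShift P₂ Q₁ ℓ''.src ℓ''.dir hcomb.1 hcomb.2
      have h1 := stageChord_treeComb_eq_one_of_top (fun k => blockAvg (P := F.P K) (j := k) ℰp) hsK lift g g₀ (fun ℓ => expPoint (ζ ℓ) * U₀ ℓ) U₁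
        (hT4 s hslt) (hT4' s hslt) htop (siteShift P₂ ℓ''.src) ℓ''.dir hblk' hlo'
      have h2 : GaugeField.gaugeAct (g s) (Averaging.iter (fun k => blockAvg (P := F.P K) (j := k) ℰp) s (fun ℓ => expPoint (ζ ℓ) * U₀ ℓ)) (bondShift P₂ ℓ'') *
          (GaugeField.gaugeAct (g₀ s) (Averaging.iter (fun k => blockAvg (P := F.P K) (j := k) ℰp) s U₁) (bondShift P₂ ℓ''))⁻¹ = 1 := by
        show GaugeField.gaugeAct (g s) _ ⟨siteShift P₂ ℓ''.src, ℓ''.dir⟩ * (GaugeField.gaugeAct (g₀ s) _ ⟨siteShift P₂ ℓ''.src, ℓ''.dir⟩)⁻¹ = 1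
        rw [h1, mul_inv_cancel]
      rw [h2, FluctuationComparisonRegPrIntLS2BetaWhitneyHatLift.logVec_su2Quat_one, norm_zero]
      exact norm_nonneg _
    · -- non-comb bond: the relative lift is `1` (equal coarse stage fields), so `η = R⁻¹η`
      rw [if_pos (And.intro hS hcomb), htop, mul_inv_cancel, inv_one, one_mul]
  · rw [if_neg hS, norm_zero]
    exact norm_nonneg _

end Summit.QuantumFields.YangMills.Theorems.FluctuationComparisonRegPrIntLS2BetaLiftLadderOneProfileTop
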